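import Summits.ResolutionOfSingularities.ResolutionOfSingularities.Theorems.LogCanQuotLU.Negative.PlaneWitness
import Literature.AlgebraicGeometry.Resolution.RegularLocalRingsQuotient
import HarnessLib

/-!
# `LogCanQuotLU` — negative lemmas, part VII: TIGHTNESS — in the multiplicative case the ring of
# constants `S'^D` is NOT regular at the centre (the `A₁` point `𝔽₂[X₀², X₀X₁, X₁²]`)

Support (negative) lemma for crux `stmt-ResolutionOfSingularities-17082`
(`Summit.ResolutionOfSingularities.ResolutionOfSingularities.Theses.FoliationDescent.LogCanQuotLU`,
route `FoliationDescent`, crux #3), filed by the standing disprover (cdisprove gen 2; work file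
`Cruxes/LogCanQuotLU/Disproof.lean` §6). This file declares NO definition and NO declaration
concludes the route decl positively.

`isRegularLocalRing_constants_false_multiplicative` refutes the natural strengthening of the crux
"the model `A := S'^D = S' ∩ K^D` of the constants is itself regular at the centre ALSO in the
multiplicative case" — verbatim the statement `Sig.stub_nonsingularDescent` of line `birth`
(`Cruxes/LogCanQuotLU/Lines/birth.lean`) with its NON-SINGULAR clause replaced by the
MULTIPLICATIVE clause of the crux (and `[PerfectField k]` added). So stub 2 of that line does not
extend to the multiplicative disjunct, and stub 3 (`stub_multiplicativeToricLU`) must genuinely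
enlarge `S'^D` inside `O ∩ K^D` (blow up): the two halves of the crux cannot be merged.

WITNESS (part V): `p = 2`, `k = 𝔽₂`, `K = 𝔽₂(X₀, X₁)`, `S' = 𝔽₂[X₀, X₁]`, `O` a valuation ring
dominating the origin, `D = E = X₀∂₀ + X₁∂₁` the Euler field (`E ∘ E = E`: multiplicative with
`u = 1`, `g = 1`; singular at the origin), `A = S'^E ∋ X₀², X₀X₁, X₁²`. PROOF that `A_𝔭`
(`𝔭` = centre of `O`) is not regular: a constant has no monomial of degree `1` (`coeff_euler`:
`E` acts on the monomial `X^m` by `m₀ + m₁`), an element of `𝔭` has no constant term, so a product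
of two elements of `𝔭` has no `X₀²`-term (`coeff_sq_mul_eq_zero`); hence `X₀² ∈ 𝔪 ∖ 𝔪²` in `A_𝔭`
(clearing denominators `t ∉ 𝔭` multiplies the `X₀²`-coefficient by `t(0) ≠ 0`). In a regular local
ring such an element is PRIME (Matsumura 14.3, tree `IsRegularLocalRing.prime_of_not_mem_sq`); but
`X₀² ∣ (X₀X₁)²= X₀²·X₁²` while `X₀² ∤ X₀X₁` (compare the `X₀X₁`-coefficients of
`t·s·X₀X₁ = t·a·X₀²`). Over `𝔽₂` this is the `A₁` surface point `v² = uw`.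

## Sources
* A. N. Rudakov, I. R. Shafarevich, Inseparable morphisms of algebraic surfaces, Izv. Akad. Nauk
  40 (1976), §1–2 (quotients by multiplicative vector fields are toric, in general singular).
  [RudakovShafarevich1976]
* H. Matsumura, *Commutative Ring Theory*, CUP 1986, Thm. 14.3. [Matsumura1987]
-/

noncomputable section

set_option linter.dupNamespace false -- mandated namespace of this single-conjunct summit

open IsLocalRing MvPolynomial
open Literature.AlgebraicGeometry.Resolution

namespace Summit.ResolutionOfSingularities.ResolutionOfSingularities.Theorems.LogCanQuotLU.Negative

section Coefficients

variable {k : Type} [Field k]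

/-- The Euler operator `X₀∂₀ + X₁∂₁` multiplies the coefficient of `X^m` by `m₀ + m₁`.
[folklore] -/
theorem coeff_euler (f : MvPolynomial (Fin 2) k) (m : Fin 2 →₀ ℕ) :
    coeff m (X 0 * pderiv 0 f + X 1 * pderiv 1 f) = ((m 0 : k) + (m 1 : k)) * coeff m f := by
  classical
  have key : ∀ i : Fin 2, coeff m (X i * pderiv i f) = (m i : k) * coeff m f := by
    intro i
    rw [coeff_X_mul']
    split_ifs with hi
    · have hmi : 1 ≤ m i := Nat.one_le_iff_ne_zero.mpr (Finsupp.mem_support_iff.mp hi)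
      rw [coeff_pderiv, tsub_add_cancel_of_le (Finsupp.single_le_iff.mpr hmi), Finsupp.tsub_apply,
        Finsupp.single_eq_same, mul_comm]
      congr 1
      obtain ⟨n, hn⟩ : ∃ n : ℕ, m i = n + 1 := ⟨m i - 1, (Nat.sub_add_cancel hmi).symm⟩
      rw [hn, Nat.add_sub_cancel]
      push_cast
      ring
    · rw [Finsupp.notMem_support_iff.mp hi, Nat.cast_zero, zero_mul]
  rw [coeff_add, key, key, add_mul]

/-- A constant of the Euler field has zero coefficient at every `X^m` with `m₀ + m₁ ≠ 0` in `k`.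
[folklore] -/
theorem coeff_eq_zero_of_euler_eq_zero {f : MvPolynomial (Fin 2) k}
    (hf : X 0 * pderiv 0 f + X 1 * pderiv 1 f = 0) (m : Fin 2 →₀ ℕ)
    (hm : ((m 0 : k) + (m 1 : k)) ≠ 0) : coeff m f = 0 := by
  have h := congrArg (coeff m) hf
  rw [coeff_euler, coeff_zero, mul_eq_zero] at h
  exact h.resolve_left hm

/-- If `f` and `g` have no monomials of degree `≤ 1` then `f g` has no `X₀²`-term. [folklore] -/
theorem coeff_sq_mul_eq_zero {f g : MvPolynomial (Fin 2) k}
    (hf : ∀ m : Fin 2 →₀ ℕ, m.degree ≤ 1 → coeff m f = 0)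
    (hg : ∀ m : Fin 2 →₀ ℕ, m.degree ≤ 1 → coeff m g = 0) :
    coeff (Finsupp.single 0 2) (f * g) = 0 := by
  classical
  rw [coeff_mul]
  refine Finset.sum_eq_zero fun x hx => ?_
  rw [Finset.HasAntidiagonal.mem_antidiagonal] at hx
  have hdeg : x.1.degree + x.2.degree = 2 := by
    rw [← map_add, hx, Finsupp.degree_single]
  rcases (show x.1.degree ≤ 1 ∨ x.2.degree ≤ 1 by omega) with h1 | h2
  · rw [hf _ h1, zero_mul]
  · rw [hg _ h2, mul_zero]

/-- `coeff_{X₀²} (f · X₀ · X₀) = f(0)`. [folklore] -/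
theorem coeff_sq_mul_X_mul_X (f : MvPolynomial (Fin 2) k) :
    coeff (Finsupp.single 0 2) (f * X 0 * X 0) = coeff 0 f := by
  classical
  have h21 : (Finsupp.single (0 : Fin 2) 2 : Fin 2 →₀ ℕ) - Finsupp.single 0 1 = Finsupp.single 0 1 := by
    rw [← Finsupp.single_tsub]
  rw [coeff_mul_X', if_pos (by simp), h21, coeff_mul_X', if_pos (by simp), tsub_self]

/-- `coeff_{X₀X₁} (f · X₀ · X₁) = f(0)`. [folklore] -/
theorem coeff_XX_mul_X_mul_X' (f : MvPolynomial (Fin 2) k) :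
    coeff (Finsupp.single 0 1 + Finsupp.single 1 1) (f * X 0 * X 1) = coeff 0 f := by
  classical
  rw [coeff_mul_X', if_pos (by simp), add_tsub_cancel_right, coeff_mul_X', if_pos (by simp),
    tsub_self]

/-- `coeff_{X₀X₁} (f · X₀ · X₀) = 0`. [folklore] -/
theorem coeff_XX_mul_X_mul_X (f : MvPolynomial (Fin 2) k) :
    coeff (Finsupp.single 0 1 + Finsupp.single 1 1) (f * X 0 * X 0) = 0 := by
  classical
  rw [coeff_mul_X', if_pos (by simp), add_tsub_cancel_left, coeff_mul_X', if_neg (by simp)]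

end Coefficients

/-- **The cone is not regular at its vertex** (abstract form of the `A₁` computation). Let `B`
be a ring with an injective ring map `π` to `k[X₀, X₁]` whose image consists of polynomials
without degree-`1` monomials and contains `X₀², X₀X₁, X₁²`, and let `P` be the prime of elements
with zero constant term. Then `B_P` is not a regular local ring: `X₀² ∈ 𝔪 ∖ 𝔪²` (a product of
two elements of `P` has no `X₀²`-term) would be prime (Matsumura 14.3,
`IsRegularLocalRing.prime_of_not_mem_sq`), yet `X₀² ∣ (X₀X₁)²` and `X₀² ∤ X₀X₁`.
[cite: Matsumura1987, Thm. 14.3] -/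
theorem not_isRegularLocalRing_atPrime_of_cone {k : Type} [Field k] {B : Type} [CommRing B]
    (π : B →+* MvPolynomial (Fin 2) k) (hπ : Function.Injective π) (P : Ideal B) [P.IsPrime]
    (hP : ∀ z : B, z ∈ P ↔ constantCoeff (π z) = 0)
    (hdeg : ∀ (z : B) (m : Fin 2 →₀ ℕ), m.degree = 1 → coeff m (π z) = 0)
    (x2 xy y2 : B) (hx2 : π x2 = X 0 * X 0) (hxy : π xy = X 0 * X 1) (hy2 : π y2 = X 1 * X 1) :
    ¬ IsRegularLocalRing (Localization.AtPrime P) := by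
  classical
  intro hreg
  have hπlow : ∀ z ∈ P, ∀ m : Fin 2 →₀ ℕ, m.degree ≤ 1 → coeff m (π z) = 0 := by
    intro z hz m hm
    rcases Nat.le_one_iff_eq_zero_or_eq_one.mp hm with h0 | h1
    · rw [(Finsupp.degree_eq_zero_iff m).mp h0, ← constantCoeff_eq, (hP z).mp hz]
    · exact hdeg z m h1
  -- `X₀² ∈ 𝔪`
  have hx2P : x2 ∈ P := (hP x2).mpr (by rw [hx2, map_mul, constantCoeff_X, zero_mul])
  have hm : algebraMap B (Localization.AtPrime P) x2 ∈ maximalIdeal (Localization.AtPrime P) :=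
    (IsLocalization.AtPrime.to_map_mem_maximal_iff (Localization.AtPrime P) P x2).mpr hx2P
  -- `X₀² ∉ 𝔪²`
  have hm2 : algebraMap B (Localization.AtPrime P) x2 ∉
      (maximalIdeal (Localization.AtPrime P)) ^ 2 := by
    intro hmem
    rw [← Localization.AtPrime.map_eq_maximalIdeal, ← Ideal.map_pow] at hmem
    obtain ⟨⟨i, s⟩, his⟩ :=
      (IsLocalization.mem_map_algebraMap_iff P.primeCompl (Localization.AtPrime P)).mp hmem
    rw [← map_mul] at his
    obtain ⟨t, ht⟩ := (IsLocalization.eq_iff_exists P.primeCompl (Localization.AtPrime P)).mp his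
    -- `ht : t * (x2 * s) = t * i` with `i ∈ P²` and `s, t ∉ P`
    have hsq : ∀ w ∈ P ^ 2, coeff (Finsupp.single 0 2) (π w) = 0 := by
      intro w hw
      rw [pow_two] at hw
      refine Submodule.mul_induction_on hw (fun b hb c hc => ?_) (fun u v hu hv => ?_)
      · rw [map_mul]
        exact coeff_sq_mul_eq_zero (hπlow b hb) (hπlow c hc)
      · rw [map_add, coeff_add, hu, hv, add_zero]
    have hti : coeff (Finsupp.single 0 2) (π ((t : B) * (i : B))) = 0 :=
      hsq _ (Ideal.mul_mem_left _ _ i.2)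
    rw [← ht, map_mul, map_mul, hx2, show π t * (X 0 * X 0 * π s) = π t * π s * X 0 * X 0 by ring,
      coeff_sq_mul_X_mul_X, ← constantCoeff_eq, map_mul] at hti
    rcases mul_eq_zero.mp hti with h0 | h0
    · exact t.2 ((hP _).mpr h0)
    · exact s.2 ((hP _).mpr h0)
  -- hence `X₀²` would be a prime element of `B_P` (Matsumura 14.3) …
  have hprime : Prime (algebraMap B (Localization.AtPrime P) x2) :=
    IsRegularLocalRing.prime_of_not_mem_sq hm hm2
  -- … but `X₀² ∣ (X₀X₁)² = X₀²·X₁²` while `X₀² ∤ X₀X₁`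
  have hdvd : algebraMap B (Localization.AtPrime P) x2 ∣
      algebraMap B (Localization.AtPrime P) xy * algebraMap B (Localization.AtPrime P) xy := by
    refine ⟨algebraMap B (Localization.AtPrime P) y2, ?_⟩
    rw [← map_mul, ← map_mul]
    congr 1
    apply hπ
    rw [map_mul, map_mul, hxy, hx2, hy2]
    ring
  have hd : algebraMap B (Localization.AtPrime P) x2 ∣ algebraMap B (Localization.AtPrime P) xy := by
    rcases hprime.dvd_or_dvd hdvd with hd | hd <;> exact hd
  obtain ⟨c, hc⟩ := hd
  obtain ⟨⟨a, s⟩, rfl⟩ := IsLocalization.mk'_surjective P.primeCompl c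
  have h2 : algebraMap B (Localization.AtPrime P) (xy * s) =
      algebraMap B (Localization.AtPrime P) (x2 * a) := by
    rw [map_mul, map_mul, hc, mul_assoc, IsLocalization.mk'_spec]
  obtain ⟨t, ht⟩ := (IsLocalization.eq_iff_exists P.primeCompl (Localization.AtPrime P)).mp h2
  have hcoeff := congrArg (fun b : B => coeff (Finsupp.single 0 1 + Finsupp.single 1 1) (π b)) ht
  rw [map_mul, map_mul, hxy, map_mul, map_mul, hx2,
    show π t * (X 0 * X 1 * π s) = π t * π s * X 0 * X 1 by ring,
    show π t * (X 0 * X 0 * π a) = π t * π a * X 0 * X 0 by ring,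
    coeff_XX_mul_X_mul_X', coeff_XX_mul_X_mul_X, ← constantCoeff_eq, map_mul] at hcoeff
  rcases mul_eq_zero.mp hcoeff with h0 | h0
  · exact t.2 ((hP _).mpr h0)
  · exact s.2 ((hP _).mpr h0)

/-- **TIGHTNESS: in the multiplicative case the constants `S'^D` are NOT regular at the centre.**
The statement `Sig.stub_nonsingularDescent` of line `birth` with its non-singular clause replaced
by the multiplicative clause of the crux (and `[PerfectField k]` added) is FALSE: witness `p = 2`,
`𝔽₂[X₀, X₁] ⊆ 𝔽₂(X₀, X₁)`, `O` dominating the origin, the Euler field `D = X₀∂₀ + X₁∂₁`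
(`D ∘ D = D`, `u = 1`), `g = 1`; the constants `A = S'^D = 𝔽₂[X₀², X₀X₁, X₁²]` form the `A₁` point:
in `A_𝔭`, `X₀² ∈ 𝔪 ∖ 𝔪²` is not prime (`X₀² ∣ (X₀X₁)²`, `X₀² ∤ X₀X₁`), contradicting
Matsumura 14.3. So the multiplicative half of `LogCanQuotLU` needs a genuine enlargement of `S'^D`
(a blow-up); stubs 2 and 3 of line `birth` cannot be merged.
[cite: RudakovShafarevich1976, §2; Matsumura1987, Thm. 14.3] -/
theorem isRegularLocalRing_constants_false_multiplicative :
    ¬ (∀ p : ℕ, p.Prime → ∀ (k K : Type) [Field k] [CharP k p] [PerfectField k] [Field K]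
        [Algebra k K] (O : ValuationSubring K) (S' : Subalgebra k K)
        (h' : S'.toSubring ≤ O.toSubring) (D : Derivation k K K) (g : K) (A : Subalgebra k K)
        (hA : A.toSubring ≤ O.toSubring),
        S'.FG → IsFractionRing S' K →
        IsRegularLocalRing (Localization.AtPrime
          (Ideal.comap (Subring.inclusion h') (IsLocalRing.maximalIdeal O))) →
        D ≠ 0 → (∃ c : K, ∀ x : K, (⇑D)^[p] x = c * D x) → g ≠ 0 →
        (∀ x : K, (∃ a b : K, a ∈ S' ∧ b ∈ S' ∧ b ≠ 0 ∧ b⁻¹ ∈ O ∧ x = a / b) →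
          ∃ a b : K, a ∈ S' ∧ b ∈ S' ∧ b ≠ 0 ∧ b⁻¹ ∈ O ∧ (g • D) x = a / b) →
        (∃ u : K, (∃ a b : K, a ∈ S' ∧ b ∈ S' ∧ b ≠ 0 ∧ b⁻¹ ∈ O ∧ u = a / b) ∧ u ≠ 0 ∧
          u⁻¹ ∈ O ∧ ∀ x : K, (⇑(g • D))^[p] x = u * (g • D) x) →
        (∀ x : K, x ∈ A ↔ (x ∈ S' ∧ D x = 0)) →
        IsRegularLocalRing (Localization.AtPrime
          (Ideal.comap (Subring.inclusion hA) (IsLocalRing.maximalIdeal O)))) := by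
  intro h
  classical
  let k : Type := ZMod 2
  let A : Type := MvPolynomial (Fin 2) k
  let K : Type := FractionRing A
  haveI : CharP K 2 := charP_of_injective_algebraMap (algebraMap k K).injective 2
  have hinj : Function.Injective (algebraMap A K) := IsFractionRing.injective A K
  obtain ⟨O, hO₀, hO₁, hO₂⟩ := exists_valuationSubring_dominating_origin k
  set S' : Subalgebra k K := (IsScalarTower.toAlgHom k A K).range with hS'
  have h' : S'.toSubring ≤ O.toSubring := plane_toSubring_le S' hS' O hO₀
  obtain ⟨E, hE, hE0, hE1, hEE⟩ := exists_eulerDerivation_plane (k := k)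
  -- the subalgebra of constants `S'^E` (kept opaque)
  obtain ⟨Ac, hAc⟩ : ∃ Ac : Subalgebra k K, ∀ x : K, x ∈ Ac ↔ (x ∈ S' ∧ E x = 0) :=
    ⟨{ carrier := {x | x ∈ S' ∧ E x = 0}
       mul_mem' := fun {a b} ha hb => ⟨S'.mul_mem ha.1 hb.1, by
         rw [Derivation.leibniz, ha.2, hb.2, smul_zero, smul_zero, add_zero]⟩
       one_mem' := ⟨S'.one_mem, E.map_one_eq_zero⟩
       add_mem' := fun {a b} ha hb => ⟨S'.add_mem ha.1 hb.1, by
         rw [map_add, ha.2, hb.2, add_zero]⟩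
       zero_mem' := ⟨S'.zero_mem, map_zero E⟩
       algebraMap_mem' := fun c => ⟨S'.algebraMap_mem c, E.map_algebraMap c⟩ }, fun x => Iff.rfl⟩
  have hAO : Ac.toSubring ≤ O.toSubring := fun x hx =>
    h' (show x ∈ S'.toSubring from ((hAc x).mp hx).1)
  -- the crux data
  have h1 : ∃ a b : K, a ∈ S' ∧ b ∈ S' ∧ b ≠ 0 ∧ b⁻¹ ∈ O ∧ (1 : K) = a / b :=
    (plane_memSc_iff S' hS' O hO₁ hO₂ _).mpr ⟨1, 1, by rw [map_one]; exact one_ne_zero,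
      by rw [map_one, div_one]⟩
  have hx₀ : algebraMap A K (X 0) ≠ 0 := (map_ne_zero_iff _ hinj).mpr (X_ne_zero _)
  have hDne : E ≠ 0 := fun h0 => by
    rw [h0, Derivation.zero_apply] at hE0
    exact hx₀ hE0.symm
  have hpc : ∃ c : K, ∀ x : K, (⇑E)^[2] x = c * E x := ⟨1, fun x => by rw [one_mul]; exact hEE x⟩
  have hE' : ∀ a : A, E (algebraMap A K a) = algebraMap A K
      (((X 0 : A) • (pderiv 0 : Derivation k A A) + (X 1 : A) • (pderiv 1 : Derivation k A A)) a) :=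
    fun a => by
      rw [hE, Derivation.add_apply, Derivation.smul_apply, Derivation.smul_apply, smul_eq_mul,
        smul_eq_mul]
  have hpres : ∀ x : K, (∃ a b : K, a ∈ S' ∧ b ∈ S' ∧ b ≠ 0 ∧ b⁻¹ ∈ O ∧ x = a / b) →
      ∃ a b : K, a ∈ S' ∧ b ∈ S' ∧ b ≠ 0 ∧ b⁻¹ ∈ O ∧ ((1 : K) • E) x = a / b := fun x hx => by
    rw [one_smul]
    exact plane_derivation_mapsTo S' hS' O hO₁ hO₂ E _ hE' x hx
  have hmult : ∃ u : K, (∃ a b : K, a ∈ S' ∧ b ∈ S' ∧ b ≠ 0 ∧ b⁻¹ ∈ O ∧ u = a / b) ∧ u ≠ 0 ∧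
      u⁻¹ ∈ O ∧ ∀ x : K, (⇑((1 : K) • E))^[2] x = u * ((1 : K) • E) x :=
    ⟨1, h1, one_ne_zero, by rw [inv_one]; exact O.one_mem, fun x => by
      rw [one_smul, one_mul]; exact hEE x⟩
  -- the strengthening, applied: `A_𝔭` would be regular
  have hreg : IsRegularLocalRing (Localization.AtPrime
      (Ideal.comap (Subring.inclusion hAO) (IsLocalRing.maximalIdeal O))) :=
    h 2 Nat.prime_two k K O S' h' E 1 Ac hAO (plane_fg S' hS') (plane_isFractionRing S' hS')
      (plane_isRegularLocalRing_centre S' hS' O h') hDne hpc one_ne_zero hpres hmult hAc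
  -- polynomial representatives: an injective ring map `π : A → k[X₀, X₁]`
  have hpre : ∀ z : Ac.toSubring, ∃ a : A, algebraMap A K a = z := fun z =>
    (plane_mem_iff S' hS' _).mp ((hAc _).mp z.2).1
  choose π₀ hπ₀ using hpre
  let π : Ac.toSubring →+* A :=
    { toFun := π₀
      map_one' := hinj (by rw [hπ₀, map_one]; rfl)
      map_mul' := fun z w => hinj (by rw [map_mul, hπ₀, hπ₀, hπ₀]; rfl)
      map_zero' := hinj (by rw [hπ₀, map_zero]; rfl)
      map_add' := fun z w => hinj (by rw [map_add, hπ₀, hπ₀, hπ₀]; rfl) }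
  have hπ : ∀ z : Ac.toSubring, algebraMap A K (π z) = z := hπ₀
  have hπinj : Function.Injective π := fun z w hzw =>
    Subtype.ext (by rw [← hπ z, ← hπ w]; exact congrArg _ hzw)
  -- membership in the centre = zero constant term
  have hP : ∀ z : Ac.toSubring,
      z ∈ Ideal.comap (Subring.inclusion hAO) (IsLocalRing.maximalIdeal O) ↔
        constantCoeff (π z) = 0 := by
    intro z
    rw [Ideal.mem_comap, IsLocalRing.mem_maximalIdeal, mem_nonunits_iff]
    constructor
    · intro hnu
      by_contra hcc
      have hz0 : (z : K) ≠ 0 := by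
        rw [← hπ z]
        exact (map_ne_zero_iff _ hinj).mpr fun h0 => hcc (by rw [h0, map_zero])
      refine hnu (IsUnit.of_mul_eq_one ⟨(z : K)⁻¹, ?_⟩ (Subtype.ext ?_))
      · rw [← hπ z]
        exact hO₁ _ hcc
      · change (z : K) * (z : K)⁻¹ = 1
        exact mul_inv_cancel₀ hz0
    · intro hcc hu
      obtain ⟨w, hw⟩ := hu.exists_right_inv
      have hw' : (z : K) * (w : K) = 1 := congrArg Subtype.val hw
      have hwinv : ((w : O.toSubring) : K) = (algebraMap A K (π z))⁻¹ := by
        rw [hπ z]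
        exact eq_inv_of_mul_eq_one_right hw'
      have hz0 : π z = 0 := hO₂ _ hcc (by rw [← hwinv]; exact Subtype.mem _)
      rw [← hπ z, hz0, map_zero, zero_mul] at hw'
      exact zero_ne_one hw'
  -- constants have no degree-one monomials
  have hdeg : ∀ (z : Ac.toSubring) (m : Fin 2 →₀ ℕ), m.degree = 1 → coeff m (π z) = 0 := by
    intro z m hm
    have hEz : X 0 * pderiv 0 (π z) + X 1 * pderiv 1 (π z) = 0 :=
      hinj (by rw [← hE, hπ, map_zero]; exact ((hAc _).mp z.2).2)
    refine coeff_eq_zero_of_euler_eq_zero hEz m ?_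
    have hsum : m 0 + m 1 = 1 := by
      have := hm
      rwa [Finsupp.degree_eq_sum, Fin.sum_univ_two] at this
    rw [← Nat.cast_add, hsum, Nat.cast_one]
    exact one_ne_zero
  -- the three test constants `X₀², X₀X₁, X₁²`
  have hmemS : ∀ a : A, algebraMap A K a ∈ S' := fun a => (plane_mem_iff S' hS' _).mpr ⟨a, rfl⟩
  have hX2 : algebraMap A K (X 0 * X 0) ∈ Ac.toSubring := (hAc _).mpr ⟨hmemS _, by
    rw [map_mul, Derivation.leibniz, hE0, smul_eq_mul]
    exact CharTwo.add_self_eq_zero _⟩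
  have hY2 : algebraMap A K (X 1 * X 1) ∈ Ac.toSubring := (hAc _).mpr ⟨hmemS _, by
    rw [map_mul, Derivation.leibniz, hE1, smul_eq_mul]
    exact CharTwo.add_self_eq_zero _⟩
  have hXY : algebraMap A K (X 0 * X 1) ∈ Ac.toSubring := (hAc _).mpr ⟨hmemS _, by
    rw [map_mul, Derivation.leibniz, hE0, hE1, smul_eq_mul, smul_eq_mul, mul_comm]
    exact CharTwo.add_self_eq_zero _⟩
  exact not_isRegularLocalRing_atPrime_of_cone π hπinj _ hP hdeg ⟨_, hX2⟩ ⟨_, hXY⟩ ⟨_, hY2⟩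
    (hinj (by rw [hπ])) (hinj (by rw [hπ])) (hinj (by rw [hπ])) hreg

end Summit.ResolutionOfSingularities.ResolutionOfSingularities.Theorems.LogCanQuotLU.Negative

end
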